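import Summits.HodgeConjecture.CorCM.TwoSexticFieldsPairStructure
import HarnessLib

/-!
# COR-CM — TWO sextic CM fields sharing `k`: the generating weight lines of `E × B₁ × B₂` are algebraic modulo
# Markman (the pair Weil weights of `B₁ × B₂` and the `k`-Weil weights of the fourfolds `B_m × E`)

Cell `pub-hodgecm2` (COR-CM), seat b30 gen 16 (2026-08-21); COUNT-NEUTRAL; theorems only, no definition, no named fact,
no `sorry`.  Third file of the series TWO-FIELD-PAIR (`CorCM/TwoSexticFieldsFrameTransfer.lean`,
`CorCM/TwoSexticFieldsPairStructure.lean`).  SETTING as there: `k = Kf i₀` imaginary quadratic (`[k:ℚ] = 2`,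
`τ(δ) = i√d`), TWO sextic fields `K_m = Kf (tl m)` (`m = 0, 1`, `[K_m:ℚ] = 6`) with ring maps `i m : k → K_m`,
realisations `A₃ j ⊨ (Kf (slots i₀ tl j); Φ₃ j)` of the three slots `(i₀, tl 0, tl 1)` — `E = A₃ 0 ⊨ (k; {τ})` (`hΨ`),
`B_{m+1} = A₃ (m+1)` with `Φ₃ (m+1)` of sign `true` exactly over the place `m` in the frame `e m` (`hΦ`, `he_sign`).
The two generator hypotheses of the assembly (`CorCM/TwoSexticFieldsPowersHodgeOfMarkman.lean`) are discharged from
Markman's fourfold theorem: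

* §1 **`weightClassesAlg_le_algebraicClasses_of_image_eq_pair6₂`** — a weight of `E × B₁ × B₂` whose model image is
  `pair6 b` lives on the slots of `B₁ × B₂`; its line is a line of the Weil plane of `(B₁ × B₂, ι₁(i₀δ) ⊕ ι₂(ī₁δ))` —
  `(3,3)`-classes on a CM abelian SIXFOLD with TWO DIFFERENT CM fields — algebraic modulo Markman
  (`weilClassesOf_biproduct_succ_le_algebraicClasses_of_markman`, from gen 13's two-field lemma
  `CMThreefoldPair.weilClassesOf_prod_le_algebraicClasses_of_markman_curveFree`), pulled back along `Fin.succ`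
  [cite: Markman2025SurveySecant, Thm. 1.2] [cite: Deligne1982HodgeCycles, §5 (c)];
* §2 **`weightClassesAlg_le_algebraicClasses_of_image_eq_weil4₂`** — a weight with model image `weil4 m b` lives on the
  slots of `B_{m+1} × E`; its line is the `±i√d`-eigenline of the Weil-type FOURFOLD `(B_{m+1} ⊞ E, ι(i_m δ) ⊞ ι_E(δ))`
  (`k`-signature `(1,2) + (1,0)`), algebraic by `WeilFourfold.weilClassesOf_le_algebraicClasses_cmThreefold_biprod_cmCurve`
  for the field `K_m`, pulled back along `(m+1, 0)` [cite: Markman2025SurveySecant, Thm. 1.2] [cite: vanGeemen1994HodgeAV, 4.9].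
The same-field file `CorCM/DihedralSexticPairCurveGenerators.lean` (gen 14) is the special case `tl = const`, `e = const`.

## References
* [Markman2025SurveySecant] E. Markman, arXiv:2509.23403, Thm. 1.2.  [vanGeemen1994HodgeAV] B. van Geemen, LNM 1594,
  3.6–3.7, 4.9.  [Deligne1982HodgeCycles] LNM 900, §5 (c).  [Milne2020HodgeClassesAV] 1.2 (a).
-/

noncomputable section

open CategoryTheory CategoryTheory.Limits NumberField

namespace Summit.HodgeConjecture.CorCM.TwoSexticFields

open Literature.AlgebraicGeometry Literature.AlgebraicGeometry.Motives Literature.AlgebraicGeometry.HodgeTheory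
open Literature.AlgebraicGeometry.ComplexMultiplication (IsCMTypeRealisation)
open Literature.AlgebraicGeometry.Pohlmann1968
open Literature.AlgebraicTopology.SingularHomology
open Literature.NumberTheory.ComplexMultiplication
open Summit.HodgeConjecture.CorCM.Census.DihedralSexticPair (weilPlus weilMinus weil_structure)
open Summit.HodgeConjecture.CorCM.Census.DihedralSexticPairCurve (Pt' weil4 pair6 mem_weil4_iff mem_pair6_iff
  gens_balanced)
open Summit.HodgeConjecture.CorCM.DihedralSexticPair (card_filter_equiv_mem comp_eq_conjugate_of_sign_false
  comp_comp_complexConj eq_or_eq_conjugate)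
open Summit.HodgeConjecture.CorCM.DihedralSexticPairCurve (weilClassesOf_biproduct_le_algebraicClasses_of_biprod)
open Summit.HodgeConjecture.CorCM.PairWeights
open Summit.HodgeConjecture.CorCM.CMWeights (weightClassesAlg_map_le_algebraicClasses sigma_map_injective)

open scoped Classical

/-! ## §1 The pair weights of `B₁ × B₂` (two fields) -/

section Generators

variable {I : Type} {Kf : I → Type} [∀ i, Field (Kf i)] [∀ i, NumberField (Kf i)]
  {i₀ : I} {tl : Fin 2 → I} {e : ∀ m : Fin 2, (Kf (tl m) →+* ℂ) ≃ ZMod 3 × Bool} {τ : Kf i₀ →+* ℂ}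
  {i : ∀ m : Fin 2, Kf i₀ →+* Kf (tl m)}
  {A₃ : Fin 3 → AbelianVariety ℂ} {Φ₃ : ∀ j : Fin 3, CMType (Kf (slots i₀ tl j))}
  {ι₃ : ∀ j, 𝓞 (Kf (slots i₀ tl j)) →+* End (A₃ j)}
  {θ₃ : ∀ j, Kf (slots i₀ tl j) →+* Module.End ℂ (complexBetti (A₃ j).X 1)}

/-- A weight is the image of its restriction to an injective sub-family of slots containing all its slots.
[folklore] -/
theorem exists_map_sigma_eq₂ {m : ℕ} (eₘ : Fin m → Fin 3) (heₘ : Function.Injective eₘ)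
    (T : Finset ((j : Fin 3) × (Kf (slots i₀ tl j) →+* ℂ))) (hT : ∀ x ∈ T, ∃ j, x.1 = eₘ j) :
    ∃ S'' : Finset ((j : Fin m) × (Kf (slots i₀ tl (eₘ j)) →+* ℂ)),
      S''.map ⟨_, sigma_map_injective (K := fun j => Kf (slots i₀ tl j)) eₘ heₘ⟩ = T ∧
        ∀ y, y ∈ S'' ↔ (⟨eₘ y.1, y.2⟩ : (j : Fin 3) × (Kf (slots i₀ tl j) →+* ℂ)) ∈ T := by
  refine ⟨Finset.univ.filter fun y => (⟨eₘ y.1, y.2⟩ : (j : Fin 3) × (Kf (slots i₀ tl j) →+* ℂ)) ∈ T,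
    ?_, fun y => by simp⟩
  ext x
  rw [Finset.mem_map]
  constructor
  · rintro ⟨y, hy, rfl⟩
    exact (Finset.mem_filter.1 hy).2
  · intro hx
    obtain ⟨j, hj⟩ := hT x hx
    obtain ⟨j', s⟩ := x
    dsimp only at hj
    subst hj
    exact ⟨⟨j, s⟩, Finset.mem_filter.2 ⟨Finset.mem_univ _, hx⟩, rfl⟩

/-- **The pair-weight lines are algebraic modulo Markman (two fields)**: a weight `T` of `E × B₁ × B₂` with model image
`pair6 b` is the weight `W₊` or `W₋` of the slots of `B₁ × B₂`, whose line is a line of the Weil plane of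
`(B₁ × B₂, ι₁(i₀δ) ⊕ ι₂(ī₁δ))`, pulled back along `Fin.succ`. [cite: Markman2025SurveySecant, Thm. 1.2]
[cite: Deligne1982HodgeCycles, §5 (c)] -/
theorem weightClassesAlg_le_algebraicClasses_of_image_eq_pair6₂ [∀ i, IsCMField (Kf i)]
    (hW4 : Markman2025_weilClasses_algebraic_abelianFourfold)
    (h6 : ∀ m : Fin 2, Module.finrank ℚ (Kf (tl m)) = 6) (h2 : Module.finrank ℚ (Kf i₀) = 2)
    {δ : 𝓞 (Kf i₀)} {d : ℕ} (hd : 0 < d) (hδ : ((δ : Kf i₀)) ^ 2 = -(d : Kf i₀))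
    (hτ : τ (δ : Kf i₀) = Complex.I * (Real.sqrt d : ℂ))
    (hA : ∀ j, IsCMTypeRealisation (Φ₃ j) (A₃ j) (ι₃ j) (θ₃ j))
    (he_sign : ∀ (m : Fin 2) (s : Kf (tl m) →+* ℂ), s.comp (i m) = τ ↔ (e m s).2 = true)
    (hΦ : ∀ (m : Fin 2) (s : Kf (tl m) →+* ℂ), s ∈ (Φ₃ m.succ).1 ↔ (e m s).2 = decide ((e m s).1.val = m.val))
    (b : Bool) (T : Finset ((j : Fin 3) × (Kf (slots i₀ tl j) →+* ℂ))) (hT : T.image (toPt₂ e τ) = pair6 b) :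
    weightClassesAlg A₃ ι₃ (2 * 3) T ≤ algebraicClasses (⨁ A₃).X 3 := by
  have hττ : ComplexEmbedding.conjugate τ ≠ τ := CMThreefoldPair.conjugate_ne_of_apply_eq hd hτ
  have hk : ∀ σ : Kf i₀ →+* ℂ, σ = τ ∨ σ = ComplexEmbedding.conjugate τ := fun σ => eq_or_eq_conjugate h2 hd hτ σ
  -- every point of `T` is on a threefold slot
  have hTslot : ∀ x ∈ T, ∃ j : Fin 2, x.1 = Fin.succ j := by
    intro x hx
    have hx' : toPt₂ e τ x ∈ pair6 b := hT ▸ Finset.mem_image_of_mem _ hx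
    rcases sigma_cases₂ x with ⟨σ, rfl⟩ | ⟨m, s, rfl⟩
    · rw [toPt₂_zero, mem_pair6_iff] at hx'
      obtain ⟨y, hy, -⟩ := hx'
      exact absurd hy (by simp)
    · exact ⟨m, rfl⟩
  obtain ⟨S'', hS''T, hS''mem⟩ := exists_map_sigma_eq₂ Fin.succ (Fin.succ_injective _) T hTslot
  -- membership and size of `S''`
  have hmemS'' : ∀ y : (j : Fin 2) × (Kf (tl j) →+* ℂ), y ∈ S'' →
      (e y.1 y.2).2 = (if b then decide (y.1 = 0) else !decide (y.1 = 0)) := by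
    intro y hy
    have hx' : toPt₂ e τ ⟨y.1.succ, y.2⟩ ∈ pair6 b := hT ▸ Finset.mem_image_of_mem _ ((hS''mem y).1 hy)
    rw [toPt₂_succ, mem_pair6_iff] at hx'
    obtain ⟨w, hw, hw'⟩ := hx'
    rw [← Sum.inr_injective hw] at hw'
    cases b
    · simp only [Bool.false_eq_true, ↓reduceIte] at hw' ⊢
      exact (weil_structure.2.1 (y.1, e y.1 y.2)).1 hw'
    · simp only [↓reduceIte] at hw' ⊢
      exact (weil_structure.1 (y.1, e y.1 y.2)).1 hw'
  have hTcard : T.card = 6 := by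
    rw [← Finset.card_image_of_injective T (toPt₂_injective hττ hk), hT]
    exact (gens_balanced.2.2 b).2.1
  have hcardS'' : S''.card = 2 * 3 := by rw [← hS''T, Finset.card_map] at hTcard; exact hTcard
  -- the data of the threefold slots, re-typed over the fields `Kf (tl j)` (definitional)
  let A' : Fin 2 → AbelianVariety ℂ := fun j => A₃ j.succ
  let ι' : ∀ j : Fin 2, 𝓞 (Kf (tl j)) →+* End (A' j) := fun j => ι₃ j.succ
  let a : ∀ j : Fin 2, 𝓞 (Kf (tl j)) := pairStructure i δ
  have hWeil : weilClassesOf (⨁ A') (biproduct.map fun j => ι' j (a j)) 3 d ≤ algebraicClasses (⨁ A').X 3 :=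
    weilClassesOf_biproduct_succ_le_algebraicClasses_of_markman hW4 h6 h2 hd hδ hτ hA he_sign hΦ
  have halg : weightClassesAlg (K := fun j => Kf (tl j)) A' ι' (2 * 3) S'' ≤ algebraicClasses (⨁ A').X 3 := by
    cases b
    · refine (weightClassesAlg_le_weilClassesMinus (K := fun j => Kf (tl j)) (A := A') (ι := ι') a hcardS''
        fun z hz => ?_).trans ((weilClassesMinus_le_weilClassesOf _ _ 3 d).trans hWeil)
      exact (apply_weilFamily_eq₂ he_sign h2 hd hτ z).2 (by simpa using hmemS'' z hz)
    · refine (weightClassesAlg_le_weilClassesPlus (K := fun j => Kf (tl j)) (A := A') (ι := ι') a hcardS''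
        fun z hz => ?_).trans ((weilClassesPlus_le_weilClassesOf _ _ 3 d).trans hWeil)
      exact (apply_weilFamily_eq₂ he_sign h2 hd hτ z).1 (by simpa using hmemS'' z hz)
  rw [← hS''T]
  exact weightClassesAlg_map_le_algebraicClasses hA Fin.succ (Fin.succ_injective _) hcardS'' halg

/-! ## §2 The `k`-Weil weights of the fourfolds `B_{m+1} × E` (two fields) -/

/-- **The `weil4` lines are algebraic modulo Markman (two fields)**: a weight `T` of `E × B₁ × B₂` with model image
`weil4 m b` lives on the slots of `B_{m+1} × E`; its line is the `±i√d`-eigenline of the Weil-type FOURFOLD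
`(B_{m+1} ⊞ E, ι(i_m δ) ⊞ ι_E(δ))` (`k`-signature `(1,2) + (1,0) = (2,2)`), algebraic by Markman's theorem (the tree's
`WeilFourfold.weilClassesOf_le_algebraicClasses_cmThreefold_biprod_cmCurve` for the field `K_m`), pulled back along the
sub-product `(m+1, 0)`. [cite: Markman2025SurveySecant, Thm. 1.2] [cite: Deligne1982HodgeCycles, §5 (c)]
[cite: vanGeemen1994HodgeAV, 4.9] -/
theorem weightClassesAlg_le_algebraicClasses_of_image_eq_weil4₂
    (hW4 : Markman2025_weilClasses_algebraic_abelianFourfold)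
    (h6 : ∀ m : Fin 2, Module.finrank ℚ (Kf (tl m)) = 6) (h2 : Module.finrank ℚ (Kf i₀) = 2)
    {δ : 𝓞 (Kf i₀)} {d : ℕ} (hd : 0 < d) (hδ : ((δ : Kf i₀)) ^ 2 = -(d : Kf i₀))
    (hτ : τ (δ : Kf i₀) = Complex.I * (Real.sqrt d : ℂ))
    (hA : ∀ j, IsCMTypeRealisation (Φ₃ j) (A₃ j) (ι₃ j) (θ₃ j))
    (he_sign : ∀ (m : Fin 2) (s : Kf (tl m) →+* ℂ), s.comp (i m) = τ ↔ (e m s).2 = true)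
    (hΨ : ∀ σ : Kf i₀ →+* ℂ, σ ∈ (Φ₃ 0).1 ↔ σ = τ)
    (hΦ : ∀ (m : Fin 2) (s : Kf (tl m) →+* ℂ), s ∈ (Φ₃ m.succ).1 ↔ (e m s).2 = decide ((e m s).1.val = m.val))
    (m : Fin 2) (b : Bool) (T : Finset ((j : Fin 3) × (Kf (slots i₀ tl j) →+* ℂ)))
    (hT : T.image (toPt₂ e τ) = weil4 m b) :
    weightClassesAlg A₃ ι₃ (2 * 2) T ≤ algebraicClasses (⨁ A₃).X 2 := by
  have hττ : ComplexEmbedding.conjugate τ ≠ τ := CMThreefoldPair.conjugate_ne_of_apply_eq hd hτ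
  have hk : ∀ σ : Kf i₀ →+* ℂ, σ = τ ∨ σ = ComplexEmbedding.conjugate τ := fun σ => eq_or_eq_conjugate h2 hd hτ σ
  have hconjτ : ComplexEmbedding.conjugate τ (δ : Kf i₀) = -(Complex.I * (Real.sqrt d : ℂ)) := by
    rw [ComplexEmbedding.conjugate_coe_eq, hτ, map_mul, Complex.conj_I, Complex.conj_ofReal, neg_mul]
  -- the sub-family `(m+1, 0)` of slots
  let e₄ : Fin 2 → Fin 3 := Fin.cons m.succ fun _ : Fin 1 => 0
  have he₄ : Function.Injective e₄ := by
    intro p q hpq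
    fin_cases p <;> fin_cases q
    · rfl
    · exact absurd hpq (Fin.succ_ne_zero m)
    · exact absurd hpq.symm (Fin.succ_ne_zero m)
    · rfl
  -- every point of `T` is on one of the two slots
  have hTslot : ∀ x ∈ T, ∃ j : Fin 2, x.1 = e₄ j := by
    intro x hx
    have hx' : toPt₂ e τ x ∈ weil4 m b := hT ▸ Finset.mem_image_of_mem _ hx
    rcases sigma_cases₂ x with ⟨σ, rfl⟩ | ⟨m', s, rfl⟩
    · exact ⟨1, rfl⟩
    · rw [toPt₂_succ, mem_weil4_iff] at hx'
      rcases hx' with h | ⟨i', h⟩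
      · exact absurd h (by simp)
      · have hm : m' = m := by
          have h' := Sum.inr_injective h
          simp only [Prod.mk.injEq] at h'
          exact h'.1
        subst hm
        exact ⟨0, rfl⟩
  obtain ⟨S'', hS''T, hS''mem⟩ := exists_map_sigma_eq₂ e₄ he₄ T hTslot
  have hTcard : T.card = 4 := by
    rw [← Finset.card_image_of_injective T (toPt₂_injective hττ hk), hT]
    exact (gens_balanced.2.1 m b).2.1
  have hcardS'' : S''.card = 2 * 2 := by rw [← hS''T, Finset.card_map] at hTcard; exact hTcard
  -- the sub-family data
  let A' : Fin 2 → AbelianVariety ℂ := fun j => A₃ (e₄ j)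
  let a' : ∀ j : Fin 2, 𝓞 (Kf (slots i₀ tl (e₄ j))) :=
    Fin.cons (RingOfIntegers.mapRingHom (i m) δ) fun _ : Fin 1 => δ
  -- eigenvalues on the points of `S''`
  have hval : ∀ z ∈ S'', z.2 ((a' z.1 : 𝓞 (Kf (slots i₀ tl (e₄ z.1)))) : Kf (slots i₀ tl (e₄ z.1))) =
      if b then Complex.I * (Real.sqrt d : ℂ) else -(Complex.I * (Real.sqrt d : ℂ)) := by
    intro z hz
    have hx' : toPt₂ e τ ⟨e₄ z.1, z.2⟩ ∈ weil4 m b := hT ▸ Finset.mem_image_of_mem _ ((hS''mem z).1 hz)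
    obtain ⟨z1, z2⟩ := z
    refine Fin.cases ?_ (fun p => ?_) z1 z2 hx'
    · -- threefold slot `m+1`: sign `b`
      intro s hs
      change toPt₂ e τ ⟨m.succ, s⟩ ∈ weil4 m b at hs
      rw [toPt₂_succ, mem_weil4_iff] at hs
      rcases hs with h | ⟨i', h⟩
      · exact absurd h (by simp)
      · have hsign : (e m s).2 = b := by
          have h' := Sum.inr_injective h
          simp only [Prod.mk.injEq] at h'
          rw [h'.2]
        show (s.comp (i m)) (δ : Kf i₀) = _
        cases b
        · have h1 : s.comp (i m) = ComplexEmbedding.conjugate τ :=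
            comp_eq_conjugate_of_sign_false (he_sign m) h2 hd hτ hsign
          rw [h1]
          exact hconjτ
        · have h1 : s.comp (i m) = τ := (he_sign m s).2 hsign
          rw [h1]
          exact hτ
    · -- the curve slot `0`: the embedding of sign `b`
      intro σ hσ
      have hp : p = 0 := Subsingleton.elim p 0
      subst hp
      change toPt₂ e τ ⟨0, σ⟩ ∈ weil4 m b at hσ
      rw [toPt₂_zero, mem_weil4_iff] at hσ
      rcases hσ with h | ⟨i', h⟩
      · have hσb : decide (σ = τ) = b := Sum.inl_injective h
        show σ (δ : Kf i₀) = _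
        cases b
        · have hσ' : σ = ComplexEmbedding.conjugate τ := (hk σ).resolve_left (of_decide_eq_false hσb)
          rw [hσ']
          exact hconjτ
        · rw [of_decide_eq_true hσb]
          exact hτ
      · exact absurd h (by simp)
  -- the Weil plane of the fourfold `A₃ (m+1) ⊞ A₃ 0`, algebraic by Markman
  let ΦB : CMType (Kf (tl m)) := Φ₃ m.succ
  let ιB : 𝓞 (Kf (tl m)) →+* End (A₃ m.succ) := ι₃ m.succ
  let θB : Kf (tl m) →+* Module.End ℂ (complexBetti (A₃ m.succ).X 1) := θ₃ m.succ
  have hB : IsCMTypeRealisation ΦB (A₃ m.succ) ιB θB := hA m.succ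
  let ΦE : CMType (Kf i₀) := Φ₃ 0
  let ιE : 𝓞 (Kf i₀) →+* End (A₃ 0) := ι₃ 0
  let θE : Kf i₀ →+* Module.End ℂ (complexBetti (A₃ 0).X 1) := θ₃ 0
  have hE : IsCMTypeRealisation ΦE (A₃ 0) ιE θE := hA 0
  have hΨE : ∀ σ : Kf i₀ →+* ℂ, σ ∈ ΦE.1 ↔ σ = τ := hΨ
  have hΦB : ∀ s : Kf (tl m) →+* ℂ, s ∈ ΦB.1 ↔ (e m s).2 = decide ((e m s).1.val = m.val) := hΦ m
  have hcount : ∀ τ' : Kf i₀ →+* ℂ,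
      (Finset.univ.filter fun s : Kf (tl m) →+* ℂ => s.comp (i m) = τ' ∧ s ∈ ΦB.1).card +
        (if τ' ∈ ΦE.1 then 1 else 0) = 2 := by
    intro τ'
    rcases hk τ' with h' | h' <;> rw [h']
    · rw [if_pos ((hΨE τ).2 rfl)]
      have hfilter : (Finset.univ.filter fun s : Kf (tl m) →+* ℂ => s.comp (i m) = τ ∧ s ∈ ΦB.1) =
          Finset.univ.filter fun s => e m s ∈
            (Finset.univ.filter fun y : ZMod 3 × Bool => y.2 = true ∧ y.1.val = m.val) := by
        refine Finset.filter_congr fun s _ => ?_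
        rw [he_sign m, hΦB s, Finset.mem_filter]
        constructor
        · rintro ⟨h1, h2⟩; rw [h1] at h2; exact ⟨Finset.mem_univ _, h1, of_decide_eq_true h2.symm⟩
        · rintro ⟨-, h1, h2⟩; exact ⟨h1, by rw [h1, decide_eq_true h2]⟩
      rw [hfilter, card_filter_equiv_mem]
      fin_cases m <;> decide
    · have hnot : ComplexEmbedding.conjugate τ ∉ ΦE.1 := fun h => hττ ((hΨE _).1 h)
      rw [if_neg hnot, add_zero]
      have hfilter : (Finset.univ.filter fun s : Kf (tl m) →+* ℂ =>
          s.comp (i m) = ComplexEmbedding.conjugate τ ∧ s ∈ ΦB.1) =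
          Finset.univ.filter fun s => e m s ∈
            (Finset.univ.filter fun y : ZMod 3 × Bool => y.2 = false ∧ ¬ y.1.val = m.val) := by
        refine Finset.filter_congr fun s _ => ?_
        rw [hΦB s, Finset.mem_filter]
        constructor
        · rintro ⟨h1, h2⟩
          have hs : (e m s).2 = false := by
            by_contra h3
            rw [Bool.not_eq_false, ← he_sign m] at h3
            exact hττ (h1 ▸ h3 ▸ rfl)
          rw [hs] at h2
          exact ⟨Finset.mem_univ _, hs, fun h4 => by rw [decide_eq_true h4] at h2; exact Bool.false_ne_true h2⟩
        · rintro ⟨-, h1, h3⟩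
          refine ⟨comp_eq_conjugate_of_sign_false (he_sign m) h2 hd hτ h1, ?_⟩
          rw [h1, decide_eq_false h3]
      rw [hfilter, card_filter_equiv_mem]
      fin_cases m <;> decide
  have hWeil4 : weilClassesOf (A₃ m.succ ⊞ A₃ 0)
      (biprod.map (ιB (RingOfIntegers.mapRingHom (i m) δ)) (ιE δ)) 2 d ≤ algebraicClasses (A₃ m.succ ⊞ A₃ 0).X 2 :=
    WeilFourfold.weilClassesOf_le_algebraicClasses_cmThreefold_biprod_cmCurve hW4 (h6 m) h2 (i m) hB hE hd hδ hcount
  have hWeil : weilClassesOf (⨁ A') (biproduct.map fun j => ι₃ (e₄ j) (a' j)) 2 d ≤ algebraicClasses (⨁ A').X 2 :=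
    weilClassesOf_biproduct_le_algebraicClasses_of_biprod (A := A') (fun j => ι₃ (e₄ j) (a' j)) hWeil4
  have halg : weightClassesAlg (K := fun j => Kf (slots i₀ tl (e₄ j))) A' (fun j => ι₃ (e₄ j)) (2 * 2) S'' ≤
      algebraicClasses (⨁ A').X 2 := by
    cases b
    · refine (weightClassesAlg_le_weilClassesMinus (K := fun j => Kf (slots i₀ tl (e₄ j))) (A := A')
        (ι := fun j => ι₃ (e₄ j)) a' hcardS'' fun z hz => ?_).trans
        ((weilClassesMinus_le_weilClassesOf _ _ 2 d).trans hWeil)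
      simpa using hval z hz
    · refine (weightClassesAlg_le_weilClassesPlus (K := fun j => Kf (slots i₀ tl (e₄ j))) (A := A')
        (ι := fun j => ι₃ (e₄ j)) a' hcardS'' fun z hz => ?_).trans
        ((weilClassesPlus_le_weilClassesOf _ _ 2 d).trans hWeil)
      simpa using hval z hz
  rw [← hS''T]
  exact weightClassesAlg_map_le_algebraicClasses hA e₄ he₄ hcardS'' halg

end Generators

end Summit.HodgeConjecture.CorCM.TwoSexticFields

end
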